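import Summits.SmoothPoincare4.SmoothPoincare4.Theorems.EntropyRungConicalGapHalfSupFence
import Summits.SmoothPoincare4.SmoothPoincare4.Theorems.EntropyRungConicalGapConeExcessMonotone
import HarnessLib

/-!
# The curvature-level fence `Θ ≤ a·e^{ρ/2}` (line `Sketch` of crux `EntropyRung.ConicalGap`,
# stmt-SmoothPoincare4-16589; lead seat c3, cycle 3)

Composition of two results landed this cycle for the cone-excess profile `m(τ) = τ⟨R⟩_τ`
(`⟨R⟩_τ = ∫Re^{-f/τ}dV / ∫e^{-f/τ}dV`) of a complete connected normalised 4-d gradient shrinking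
Ricci soliton:

* `helper_coneExcess_monotoneOn` (p132548): the CURVATURE-LEVEL CONDITION
  `P : ∀ τ ≥ 1, ∫ (f − τ) R e^{-f/τ} dV ≥ 0` ("on `e^{-f/τ} R dV`-average the potential sits at
  level at least `τ`") makes `m` non-decreasing on `[1, ∞)`
  (`m′ = [⟨(f − τ)R⟩_τ + (τ − 1)⟨R⟩_τ²]/τ`);
* `HalfSup.density_le_of_monotone` (p131843): for non-decreasing `m` with limit `ρ` and
  regularised asymptotic volume ratio `h(T) → a`, the UNCONDITIONAL half fence
  `∫ e^{-f} dV ≤ 16π² · a · e^{ρ/2}` (exact log-transform of the Wang–Wang ODE, no Li–Wang).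

Hence (`helper_density_le_of_curvatureLevel`) `Θ ≤ AVR · e^{ρ/2}` for every shrinker satisfying `P`,
and (`helper_conicalGap_of_curvatureLevel`) the crux `ConicalGap` on the sub-class
`{P, h → a, m → ρ, 16π² a e^{ρ/2} ≤ 32π²√π e^{-3/2}}` — e.g. FIK-type data (`P` holds on FIK in
closed form: `⟨fR⟩_τ − τ⟨R⟩_τ = (2√2 − 2)(2 − √2)/(τ + √2) > 0`; `a e^{ρ/2} = .757 < .791`).
Everything here is proved; no definition and no named fact is introduced or assumed.

## References

* Y. Wang, G. Wang (Wang–Wang 2023), arXiv:2308.06560, Prop. 2.6 (the ODE for `h`).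
-/

noncomputable section

-- `Summit.SmoothPoincare4.SmoothPoincare4.…` (summit = problem) trips `dupNamespace` on every decl.
set_option linter.dupNamespace false

open scoped Manifold ContDiff ENNReal NNReal Topology
open MeasureTheory Set Filter
open Literature.Geometry.Lorentzian Literature.Geometry.Riemannian

namespace Summit.SmoothPoincare4.SmoothPoincare4.Theorems.ConicalGapSketch

/-- **Helper `helper_density_le_of_curvatureLevel` of line `Sketch` — the curvature-level fence**
(UNCONDITIONAL): on every complete connected normalised 4-d gradient shrinker satisfying
`∫ (f − τ) R e^{-f/τ} dV ≥ 0` for all `τ ≥ 1`, if `(16π²T²)⁻¹ ∫ e^{-f/T} dV → a` and `T⟨R⟩_T → ρ`, then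
`∫ e^{-f} dV ≤ 16π² · a · e^{ρ/2}`, i.e. `Θ ≤ AVR · e^{ρ/2}` (`ρ = (R̄_h − 6)/4` on an asymptotically
conical shrinker). -/
theorem helper_density_le_of_curvatureLevel : ∀ (M : Type) [TopologicalSpace M] [T2Space M] [SecondCountableTopology M] [ChartedSpace (EuclideanSpace ℝ (Fin 4)) M] [IsManifold (𝓡 4) ∞ M] [ConnectedSpace M] [T3Space M] [MeasurableSpace M] [BorelSpace M] (g : Literature.Geometry.Lorentzian.PseudoRiemannianMetric (𝓡 4) ∞ (EuclideanSpace ℝ (Fin 4)) (TangentSpace (𝓡 4) : M → Type _)) [g.HasLeviCivita] (f : M → ℝ) (hg : g.IsRiemannian), (∀ (x : M) (r : NNReal), IsCompact {y : M | g.edist hg x y ≤ r}) → ContMDiff (𝓡 4) 𝓘(ℝ, ℝ) ∞ f → (∀ (x : M) (X Y : TangentSpace (𝓡 4) x), g.ricci x X Y + g.hessian f x X Y = (1 / 2 : ℝ) * g.val x X Y) → (∀ x : M, g.scalarCurvature x + g.gradSq f x = f x) → (∀ τ : ℝ, 1 ≤ τ → 0 ≤ ∫ x, (f x - τ) * g.scalarCurvature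 x * Real.exp (-f x / τ) ∂(Literature.Geometry.Lorentzian.riemannianMeasure (g.toContMDiffRiemannianMetric hg))) → ∀ a ρ : ℝ, Filter.Tendsto (fun T : ℝ ↦ (16 * Real.pi ^ 2 * T ^ 2)⁻¹ * ∫ x, Real.exp (-f x / T) ∂(Literature.Geometry.Lorentzian.riemannianMeasure (g.toContMDiffRiemannianMetric hg))) Filter.atTop (nhds a) → Filter.Tendsto (fun T : ℝ ↦ T * ((∫ x, g.scalarCurvature x * Real.exp (-f x / T) ∂(Literature.Geometry.Lorentzian.riemannianMeasure (g.toContMDiffRiemannianMetric hg))) / (∫ x, Real.exp (-f x / T) ∂(Literature.Geometry.Lorentzian.riemannianMeasure (g.toContMDiffRiemannianMetric hg))))) Filter.atTop (nhds ρ) → ∫ x, Real.exp (-f x) ∂(Literature.Geometry.Lorentzian.riemannianMeasure (g.toContMDiffRiemannianMetric hg)) ≤ 16 * Real.pi ^ 2 * a * Real.exp (ρ / 2) := by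
  intro M _ _ _ _ _ _ _ _ _ g _ f hg hc hf hsol hnorm hP a ρ ha hρ
  have hmono := helper_coneExcess_monotoneOn M g f hg hc hf hsol hnorm hP
  rw [← PseudoRiemannianMetric.riemVolume_eq hg] at ha hρ hmono ⊢
  refine HalfSup.density_le_of_monotone g f hg hc hf hsol hnorm ha (fun τ τ' hτ hττ' ↦ ?_) hρ
  exact hmono (show τ ∈ Set.Ici (1 : ℝ) from hτ) (show τ' ∈ Set.Ici (1 : ℝ) from hτ.trans hττ') hττ'

/-- **Helper `helper_conicalGap_of_curvatureLevel` of line `Sketch` — the crux on the CURVATURE-LEVEL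
sub-class** (UNCONDITIONAL): a shrinker of the crux class (complete connected non-compact non-flat
normalised 4-d gradient shrinker with `R → 0` at infinity) with `∫ (f − τ) R e^{-f/τ} dV ≥ 0` for all
`τ ≥ 1`, regularised AVR `a`, cone excess `ρ = lim T⟨R⟩_T` and `16π² a e^{ρ/2} ≤ 32π²√π e^{-3/2}`
(i.e. `AVR · e^{(R̄_h − 6)/8} ≤ Θ(S³×ℝ) = .791`) satisfies the conclusion of `EntropyRung.ConicalGap`.
(Non-flatness, non-compactness and the decay clause are not used.) -/
theorem helper_conicalGap_of_curvatureLevel : ∀ (M : Type) [TopologicalSpace M] [T2Space M] [SecondCountableTopology M] [ChartedSpace (EuclideanSpace ℝ (Fin 4)) M] [IsManifold (𝓡 4) ∞ M] [ConnectedSpace M] [NoncompactSpace M] [T3Space M] [MeasurableSpace M] [BorelSpace M] (g : Literature.Geometry.Lorentzian.PseudoRiemannianMetric (𝓡 4) ∞ (EuclideanSpace ℝ (Fin 4)) (TangentSpace (𝓡 4) : M → Type _)) [g.HasLeviCivita] (f : M → ℝ) (hg : g.IsRiemannian), (∀ (x : M) (r : NNReal), IsCompact {y : M | g.edist hg x y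 ≤ r}) → ContMDiff (𝓡 4) 𝓘(ℝ, ℝ) ∞ f → (∀ (x : M) (X Y : TangentSpace (𝓡 4) x), g.ricci x X Y + g.hessian f x X Y = (1 / 2 : ℝ) * g.val x X Y) → (∀ x : M, g.scalarCurvature x + g.gradSq f x = f x) → (∃ x : M, g.scalarCurvature x ≠ 0) → (∀ ε : ℝ, 0 < ε → ∃ K : Set M, IsCompact K ∧ ∀ x, x ∉ K → g.scalarCurvature x < ε) → (∀ τ : ℝ, 1 ≤ τ → 0 ≤ ∫ x, (f x - τ) * g.scalarCurvature x * Real.exp (-f x / τ) ∂(Literature.Geometry.Lorentzian.riemannianMeasure (g.toContMDiffRiemannianMetric hg))) → ∀ a ρ : ℝ, Filter.Tendsto (fun T : ℝ ↦ (16 * Real.pi ^ 2 * T ^ 2)⁻¹ * ∫ x, Real.exp (-f x / T) ∂(Literature.Geometry.Lorentzian.riemannianMeasure (g.toContMDiffRiemannianMetric hg))) Filter.atTop (nhds a) → Filter.Tendsto (fun T : ℝ ↦ T * ((∫ x, g.scalarCurvature x * Real.exp (-f x / T) ∂(Literature.Geometry.Lorentzian.riemannianMeasure (g.toContMDiffRiemannianMetric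 hg))) / (∫ x, Real.exp (-f x / T) ∂(Literature.Geometry.Lorentzian.riemannianMeasure (g.toContMDiffRiemannianMetric hg))))) Filter.atTop (nhds ρ) → 16 * Real.pi ^ 2 * a * Real.exp (ρ / 2) ≤ 32 * Real.pi ^ 2 * Real.sqrt Real.pi * Real.exp (-(3 : ℝ) / 2) → ∫⁻ x, ENNReal.ofReal (Real.exp (-f x)) ∂(Literature.Geometry.Lorentzian.riemannianMeasure (g.toContMDiffRiemannianMetric hg)) ≤ ENNReal.ofReal (32 * Real.pi ^ 2 * Real.sqrt Real.pi * Real.exp (-(3 : ℝ) / 2)) := by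
  intro M _ _ _ _ _ _ _ _ _ _ g _ f hg hc hf hsol hnorm _ _ hP a ρ ha hρ hbudget
  have hfence := helper_density_le_of_curvatureLevel M g f hg hc hf hsol hnorm hP a ρ ha hρ
  obtain ⟨hI1, -, -⟩ := stub_weightedIntegrability M g f hg hc hf hsol hnorm 1 one_pos
  have hI1' : Integrable (fun x ↦ Real.exp (-f x))
      (riemannianMeasure (g.toContMDiffRiemannianMetric hg)) := by
    simpa only [div_one] using hI1
  rw [← ofReal_integral_eq_lintegral_ofReal hI1' (ae_of_all _ fun x ↦ (Real.exp_pos _).le)]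
  exact ENNReal.ofReal_le_ofReal (hfence.trans hbudget)

end Summit.SmoothPoincare4.SmoothPoincare4.Theorems.ConicalGapSketch

end
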